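import Mathlib.SetTheory.Ordinal.Principal
import Mathlib.SetTheory.Ordinal.Exponential
import Mathlib.Data.Nat.Size
import Literature.Algebra.EuclideanDomain.TransfiniteSmallestAlgorithmSuperadditive
import HarnessLib

/-!
# The Euclidean order type of a Euclidean domain is an indecomposable ordinal `ω^α`
# (Conidis–Nielsen–Tombs 2019, Corollary 6)

Topic `Literature/Algebra/EuclideanDomain`, namespace `Literature.Algebra.EuclideanDomain`.  THEOREMS ONLY (no `def`, no
instance, no named fact), all proved, in the vocabulary of `TransfiniteSmallestAlgorithm.lean` (`samuelSet R α = A_α`,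
`samuelRank x = θ(x)`; the minimal norm of Conidis–Nielsen–Tombs is `τ(x) = θ(x) − 1` on `x ≠ 0`, see
`TransfiniteSmallestAlgorithmSuperadditive.lean`).

## Source (read at the page)

C. J. Conidis, P. P. Nielsen, V. Tombs, *Transfinitely valued Euclidean domains have arbitrary indecomposable order
type*, Comm. Algebra **47** (2019) [ConidisNielsenTombs2019] (materialised `paper:arxiv-1703.02631`), VERBATIM.  §2
(p0004): «An ordinal is (additively) indecomposable if it is nonzero and cannot be written as a sum of two smaller
ordinals.  These are precisely the ordinals of the form `ω^α` for some `α ∈ Ord`.»  §1 (p0003): «we define the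
Euclidean order type of a Euclidean domain `R` to be `min_φ {α ∈ Ord : φ(R∖{0}) ⊆ α}` where `φ` ranges among all
possible Euclidean norms on `R`.  The finitely valued Euclidean domains have two different possible Euclidean order
types; fields have type `ω⁰ = 1`, and non-fields have type `ω¹ = ω`.»  §3 (p0005), Prop. 4: «`τ(R∖{0}) = ρ(R)` is the
Euclidean order type of `R`».  **Corollary 6.** «If `R` is a Euclidean domain, then its Euclidean order type is an
indecomposable ordinal.»  Proof: «Let `τ` be the minimal Euclidean norm for `R`, and write the Euclidean order type of
`R` in Cantor normal form as `ρ(R) = ω^{α₁}n₁ + ω^{α₂}n₂ + ⋯ + ω^{α_k}n_k`.  If we suppose, by way of contradiction, that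
`ω^{α₁} < ρ(R)`, there then exists some element `x ∈ R∖{0}` with `τ(x) = ω^{α₁}`.  By Lemma 5,
`τ(x^{n₁+1}) ≥ ⊕_{i=1}^{n₁+1} τ(x) = ω^{α₁}(n₁ + 1) > ρ(R)`, giving us the needed contradiction.»  (Theorem 2, second
half: «these are the only possible Euclidean order types for Euclidean domains».)

## What is formalised

For a ring `R` exhausted by its transfinite construction the Euclidean order type `ρ(R) = τ(R∖{0})` (an initial segment
of the ordinals, `exists_samuelRank_eq_of_lt`) is written as the ordinal `⨆ z : R, ((θ(z) − 1) + 1)` — the least ordinal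
exceeding every value `τ(z) = θ(z) − 1` (`samuelRank_sub_one_lt_iSup`, `exists_samuelRank_sub_one_eq`: every smaller
ordinal is a value; `z = 0` contributes `1` like the units).  **Corollary 6** for a domain:
`iSup_samuelRank_eq_omega0_opow` (`ρ(R) = ω^a` with `a = log_ω ρ(R)`: otherwise `ω^a < ρ(R) < ω^a · n` for some
`n < ω` by `Ordinal.lt_opow_succ_log_self` — this replaces the Cantor normal form —, an element `y` with `τ(y) = ω^a`
exists, and Lemma 5 in the power form `τ(yⁿ) ≥ τ(y)·n` (`samuelRank_sub_one_mul_le`) exceeds `ρ(R)`), and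
`isPrincipal_add_iSup_samuelRank` (`ρ(R)` is additively indecomposable, Mathlib's `Ordinal.IsPrincipal (· + ·)`).
§2: «non-fields [finitely valued] have type `ω¹ = ω`» for `ℤ`: `Int.iSup_samuelRank_eq_omega0`; fields have type `1`:
`iSup_samuelRank_eq_one_of_field`.

## Mathlib / tree search

Mathlib: `Ordinal.IsPrincipal`, `Ordinal.isPrincipal_add_omega0_opow`, `Ordinal.log`, `Ordinal.opow_log_le_self`,
`Ordinal.lt_opow_succ_log_self`, `Ordinal.lt_mul_iff_of_isSuccLimit`, `Ordinal.isSuccLimit_omega0`, `Ordinal.lt_iSup_iff`,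
`Ordinal.omega0_le`, `Nat.size_pow`.  Tree: `TransfiniteSmallestAlgorithm.lean` (`samuelRank_zero`, `Int.samuelRank_eq`,
`Int.iUnion_samuelSet_natCast`, `samuelRank_eq_one_iff`), `TransfiniteSmallestAlgorithmSuperadditive.lean`
(`exists_samuelRank_eq_of_lt'`, `samuelRank_sub_one_mul_le`).
-/

namespace Literature.Algebra.EuclideanDomain

open Ordinal

universe u

variable {R : Type u} [CommRing R]

/-! ## §1 The Euclidean order type `ρ(R) = sup_z (τ(z) + 1)` -/

/-- Every value `τ(z) = θ(z) − 1` lies below `ρ(R) = ⨆_z (τ(z) + 1)`. [cite: ConidisNielsenTombs2019, Prop. 4 (§3)] -/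
theorem samuelRank_sub_one_lt_iSup (x : R) :
    samuelRank x - 1 < ⨆ z : R, (samuelRank z - 1 + 1) :=
  (lt_add_one _).trans_le (Ordinal.le_iSup (fun z : R ↦ samuelRank z - 1 + 1) x)

/-- `ρ(R) ≠ 0`. [cite: ConidisNielsenTombs2019, Prop. 4 (§3)] -/
theorem iSup_samuelRank_ne_zero : (⨆ z : R, (samuelRank z - 1 + 1)) ≠ 0 :=
  (lt_of_le_of_lt bot_le (samuelRank_sub_one_lt_iSup (0 : R))).ne'

/-- «`τ(R∖{0}) = ρ(R)`»: every ordinal below `ρ(R)` is a value `τ(y)` (the values form an initial segment,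
`exists_samuelRank_eq_of_lt'`). [cite: ConidisNielsenTombs2019, Prop. 4 (§3)] -/
theorem exists_samuelRank_sub_one_eq (h : ∀ z : R, ∃ β : Ordinal.{u}, z ∈ samuelSet R β) {α : Ordinal.{u}}
    (hα : α < ⨆ z : R, (samuelRank z - 1 + 1)) : ∃ y : R, samuelRank y - 1 = α := by
  rw [Ordinal.lt_iSup_iff] at hα
  obtain ⟨x, hx⟩ := hα
  have hle : α ≤ samuelRank x - 1 := Order.lt_add_one_iff.1 hx
  rcases hle.eq_or_lt with heq | hlt
  · exact ⟨x, heq.symm⟩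
  · have hx0 : x ≠ 0 := by
      rintro rfl
      rw [samuelRank_zero, Ordinal.zero_sub] at hlt
      exact not_lt_bot hlt
    have h1 : 1 + α < samuelRank x := by
      have := (add_lt_add_iff_left 1).2 hlt
      rwa [one_add_samuelRank_sub_one h hx0] at this
    obtain ⟨y, hy⟩ := exists_samuelRank_eq_of_lt' h h1
    exact ⟨y, by rw [hy, Ordinal.add_sub_cancel]⟩

/-! ## §2 Corollary 6 -/

section Domain

variable [IsDomain R]

/-- **Corollary 6 / Theorem 2 (second half).**  For a Euclidean domain (a domain exhausted by its transfinite
construction) the Euclidean order type is a power of `ω`: `ρ(R) = ω^a`, `a = log_ω ρ(R)` («these are the only possible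
Euclidean order types»). [cite: ConidisNielsenTombs2019, Cor. 6 (§3) and Thm. 2] -/
theorem iSup_samuelRank_eq_omega0_opow (h : ∀ z : R, ∃ β : Ordinal.{u}, z ∈ samuelSet R β) :
    (⨆ z : R, (samuelRank z - 1 + 1)) = ω ^ Ordinal.log ω (⨆ z : R, (samuelRank z - 1 + 1)) := by
  set ρ : Ordinal.{u} := ⨆ z : R, (samuelRank z - 1 + 1) with hρ
  have hρ0 : ρ ≠ 0 := iSup_samuelRank_ne_zero
  have hle : ω ^ Ordinal.log ω ρ ≤ ρ := Ordinal.opow_log_le_self ω hρ0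
  rcases hle.eq_or_lt with heq | hlt
  · exact heq.symm
  · exfalso
    -- `ρ < ω^(log ρ + 1) = ω^(log ρ) · ω`, hence `ρ < ω^(log ρ) · n` for some `n < ω`
    have hlt2 : ρ < ω ^ Ordinal.log ω ρ * ω := by
      have := Ordinal.lt_opow_succ_log_self one_lt_omega0 ρ
      rwa [Order.succ_eq_add_one, Ordinal.opow_add_one] at this
    obtain ⟨c, hc, hρc⟩ := (Ordinal.lt_mul_iff_of_isSuccLimit Ordinal.isSuccLimit_omega0).1 hlt2
    obtain ⟨n, rfl⟩ := Ordinal.lt_omega0.1 hc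
    -- an element `y` with `τ(y) = ω^(log ρ)` («there then exists some element `x` with `τ(x) = ω^{α₁}`»)
    obtain ⟨y, hy⟩ := exists_samuelRank_sub_one_eq h hlt
    have hy0 : y ≠ 0 := by
      rintro rfl
      rw [samuelRank_zero, Ordinal.zero_sub] at hy
      exact Ordinal.opow_ne_zero _ omega0_ne_zero hy.symm
    -- Lemma 5: `τ(yⁿ) ≥ τ(y)·n = ω^(log ρ)·n > ρ > τ(yⁿ)`
    have hpow := samuelRank_sub_one_mul_le h hy0 n
    rw [hy] at hpow
    exact lt_irrefl _ ((hpow.trans_lt (samuelRank_sub_one_lt_iSup (y ^ n))).trans hρc)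

/-- **Corollary 6.** «If `R` is a Euclidean domain, then its Euclidean order type is an indecomposable ordinal»
(additively principal: `a, b < ρ(R) ⟹ a + b < ρ(R)`). [cite: ConidisNielsenTombs2019, Cor. 6 (§3)] -/
theorem isPrincipal_add_iSup_samuelRank (h : ∀ z : R, ∃ β : Ordinal.{u}, z ∈ samuelSet R β) :
    Ordinal.IsPrincipal (· + ·) (⨆ z : R, (samuelRank z - 1 + 1)) := by
  rw [iSup_samuelRank_eq_omega0_opow h]
  exact Ordinal.isPrincipal_add_omega0_opow _

/-- Corollary 6 spelled out: the sum of two values `τ(x) + τ(y)` is again below `ρ(R)`, i.e. is a value `τ(z)`.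
[cite: ConidisNielsenTombs2019, Cor. 6 (§3)] -/
theorem exists_samuelRank_sub_one_eq_add (h : ∀ z : R, ∃ β : Ordinal.{u}, z ∈ samuelSet R β) (x y : R) :
    ∃ z : R, samuelRank z - 1 = (samuelRank x - 1) + (samuelRank y - 1) :=
  exists_samuelRank_sub_one_eq h
    (isPrincipal_add_iSup_samuelRank h (samuelRank_sub_one_lt_iSup x) (samuelRank_sub_one_lt_iSup y))

end Domain

/-! ## §3 The two finitely valued types: `1` for fields, `ω` for `ℤ` -/

/-- «fields have type `ω⁰ = 1`»: if every non-zero element is a unit then `θ ≤ 1`, all `τ`-values are `0`, and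
`ρ(R) = 1`. [cite: ConidisNielsenTombs2019, §1] -/
theorem iSup_samuelRank_eq_one_of_field (hR : ∀ x : R, x ≠ 0 → IsUnit x) :
    (⨆ z : R, (samuelRank z - 1 + 1)) = 1 := by
  have hval : ∀ z : R, samuelRank z - 1 = 0 := by
    intro z
    by_cases hz : z = 0
    · rw [hz, samuelRank_zero, Ordinal.zero_sub]
    · rw [samuelRank_eq_one_iff.2 ⟨hz, hR z hz⟩, Ordinal.sub_self]
  refine le_antisymm (Ordinal.iSup_le fun z ↦ by rw [hval z, zero_add]) ?_
  have := Ordinal.le_iSup (fun z : R ↦ samuelRank z - 1 + 1) 0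
  rwa [hval 0, zero_add] at this

/-- «non-fields [with a finitely valued norm] have type `ω¹ = ω`», for `ℤ`: `τ(b) = size |b| − 1` takes every
natural value (`τ(2ⁿ) = n`) and only those, so `ρ(ℤ) = ω`. [cite: ConidisNielsenTombs2019, §1] -/
theorem Int.iSup_samuelRank_eq_omega0 : (⨆ z : ℤ, (samuelRank z - 1 + 1)) = ω := by
  refine le_antisymm (Ordinal.iSup_le fun z ↦ ?_) (Ordinal.omega0_le.2 fun n ↦ ?_)
  · -- every term `τ(z) + 1` is finite
    rw [Int.samuelRank_eq]
    obtain ⟨m, hm⟩ := Ordinal.lt_omega0.1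
      ((Ordinal.sub_le_self _ _).trans_lt (Ordinal.natCast_lt_omega0 z.natAbs.size))
    rw [hm, ← Nat.cast_succ]
    exact (Ordinal.natCast_lt_omega0 _).le
  · -- `τ(2ⁿ) = n`: `θ(2ⁿ) = size (2ⁿ) = n + 1 = 1 + n`
    have h2 : samuelRank ((2 : ℤ) ^ n) - 1 = (n : Ordinal) := by
      rw [Int.samuelRank_eq, Int.natAbs_pow, show (2 : ℤ).natAbs = 2 from rfl, Nat.size_pow, Nat.cast_succ,
        Nat.cast_add_one_comm, Ordinal.add_sub_cancel]
    calc (n : Ordinal) ≤ (n : Ordinal) + 1 := le_self_add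
      _ = samuelRank ((2 : ℤ) ^ n) - 1 + 1 := by rw [h2]
      _ ≤ ⨆ z : ℤ, (samuelRank z - 1 + 1) := Ordinal.le_iSup (fun z : ℤ ↦ samuelRank z - 1 + 1) ((2 : ℤ) ^ n)

end Literature.Algebra.EuclideanDomain
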